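import Literature.IUT.HodgeTheaters.Cor53iFcircLiftsAllAtKerStablePushCarrier
import Literature.IUT.HodgeTheaters.Cor53iFcircHdescNotAtNormalClosureCarrier
import Literature.IUT.HodgeTheaters.GlobalFrobenioidsArithmeticClosers
import Literature.AnabelianGeometry.AbsoluteAnabelian.AbsTopIThm17Proofs
import Literature.AnabelianGeometry.AbsoluteAnabelian.AbsTopIII.BiAnabelianModelLiftVacuity
import Literature.AnabelianGeometry.SemiGraphs.TemperedSpecialFibreTowerFreeProfiniteWitness
import HarnessLib

/-!
# [IUTchI] Cor 5.3 (i) «respectively ⊚» at a Galois push carrier `ι : H → G_F`: the LIFT-route law KER-STABLE is AUTOMATIC whenever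
# `Ker ι` is topologically finitely generated — by [AbsAnab] Thm 1.1.2 (a THEOREM of the tree); hence «⊚ bijective» at every slim
# Galois-countable push carrier with tfg kernel, and an INHABITED NON-INJECTIVE such carrier `F̂₂ × G_F ↠ G_F`

S. Mochizuki, *Inter-universal Teichmüller theory I*, kurims manuscript (May 2020), §5 Cor 5.3 (i) p. 144 l. 2–11, proof l. 24–33;
Example 5.1 (i) p. 123 l. 33–38, (iii) pp. 125–126 ([IUTchI] Cor 5.3 (i) p.144) [claim: Mochizuki2012, status: disputed] (D-0012 claim
key; PROOFS ONLY over landed files; nothing of the series is asserted; no side taken on [IUTchIII] Cor. 3.12).  CLASSICAL inputs (OURS, all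
THEOREMS of the tree): [AbsAnab] Thm 1.1.2 «every topologically finitely generated closed normal subgroup of `G_F` is trivial» in the
open-subgroup form of [AbsTopI] Thm 1.7 (iii) (abc-iut-L4's ★ `eq_bot_of_tfg_normal_of_isOpen_absoluteGaloisGroup_numberField`, over ★
`galoisNF_tfgNormalSubgroup_trivial_holds`) [cite: MochizukiAbsAnab2004, Thm 1.1.2 p.6] [cite: MochizukiAbsTopI2012, Thm 1.7 (iii) p.14];
[AbsAnab] Thm 1.1.1 (ii) (`G_F` slim, ★ `isSlimGroup_absGalGrp`) [cite: MochizukiAbsAnab2004, Thm 1.1.1 (ii) p.6]; [SemiAnbd] Ex 3.10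
(`F̂₂` slim / topologically finitely generated / Galois-countable / infinite — ★ `isSlimGroup_profiniteCompletion_freeGroupTwo`, ★
`isTopologicallyFinitelyGenerated_profiniteCompletion_freeGroupTwo`, ★ `secondCountableTopology_profiniteCompletion_freeGroup`, ★
`infinite_profiniteCompletion_freeGroupTwo`) [cite: MochizukiSemiAnbd2006, Ex 3.10 p.44]; [NSW] Thm (12.2.1) (Neukirch–Uchida, ★
`neukirchUchida_holds`, consumed only through ★ `Cor53iFcircLiftsAllAtKerStablePushCarrier`) [cite: NeukirchSchmidtWingberg2008, Thm (12.2.1)].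

PROOF-ONLY (cell abc-iut, seat abc-iut-L5-t11 gen 44, private scoping on the lineage's own open faces (a)/(b) of gen 23's HANDOFF record for ★
`Cor53iFcircLiftsAllAtKerStablePushCarrier` (p569032); 0 def · 0 instance · 0 abbrev · 0 notation · no Prop fact · no sorry).  gen 23 proved, at
an ARBITRARY continuous open `ι : H → G_F` (`H` profinite, Galois-countable), the LIFT-route law `hlift⊚ ⟸ KER-STABLE` («every topological
automorphism of `H` maps `Ker ι` into `Ker ι`», ⟺ Neukirch–Uchida-compatibility, FACT-free) and «⊚ bijective» ⟸ {KER-STABLE} · {`H` slim}; it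
left open (a) a structural source of KER-STABLE beyond injectivity and (b) an inhabited NON-injective KER-STABLE slim carrier.  THIS FILE:
* §1 **`kerStable_of_isTopologicallyFinitelyGenerated_ker`** — KER-STABLE holds for EVERY continuous open `ι : H → G_F` whose kernel is
  topologically finitely generated: `ι(φ(Ker ι))` is a topologically finitely generated (continuous image), closed (compact image), normal
  (`ι` maps onto the open subgroup `ι(H)`) subgroup of the open subgroup `ι(H) ≤ G_F`, hence TRIVIAL by [AbsAnab] Thm 1.1.2 / [AbsTopI] Thm 1.7
  (iii) — no Neukirch–Uchida, no slimness, no countability needed for the law itself; corollary `nuCompatible_of_isTopologicallyFinitelyGenerated_ker`;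
* §2 KNIT with ★ p569032 §2/§3: **`GlobalFrobenioid.liftsAll_fcircBase_arith_of_pushCarrier_of_tfg_ker`** (`hlift⊚` for EVERY record) and
  **`Cor53.fcirc_descendBijective_of_pushCarrier_of_tfg_ker`** — «⊚ bijective» at every slim Galois-countable push carrier with tfg kernel:
  LAW ∅ · FACT ∅ · SIDE {`hZ : H` slim, `Ker ι` tfg} — the PRINT-SHAPED class (an arithmetic-fundamental-group-like `H ↠ G_K ≤ G_F` whose
  geometric part `Ker ι` is topologically finitely generated; cf. [AbsAnab] Lemma 1.1.4 (i) / [AbsTopI] Thm 2.6 (vi), where the same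
  theorem is what singles out `Δ_X` inside `Π_X` over a number field);
* §3 INHABITED NON-INJECTIVE INSTANCE (face (b)): `H := F̂₂ × G_F`, `ι := pr₂` — kernel `F̂₂ × 1` tfg and INFINITE (`not_injective_snd_freeProfiniteTwo_prod`),
  `H` slim (products of slim groups) and Galois-countable; **`kerStable_sndPushCarrier_freeProfiniteTwo`**, **`Cor53.nonempty_and_fcirc_descendBijective_sndPushCarrier_freeProfiniteTwo`**
  (record type INHABITED and «⊚ bijective» for EVERY inhabitant) — to be read AGAINST ★ p569032 §4 / ★ `Cor53.nonempty_and_not_liftsAll_fstPushCarrier`: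
  at `G_F × G_F ↠ G_F` the kernel `G_F` is NOT topologically finitely generated (★ `not_isTopologicallyFinitelyGenerated_absoluteGaloisGroup`) and
  KER-STABLE / `hlift⊚` FAIL.  CENSUS NOTE for face (b) as worded by gen 23 («`H = G_F × P`, `1 × P` torsion/characteristic»): excluded by §3's
  `hZ` of ★ p569032 — a slim group has no non-trivial finite normal subgroup (★ `eq_bot_of_finite_normal_of_isSlimGroup`, ★ `not_isSlimGroup_prod`),
  so any non-injective KER-STABLE carrier in that theorem's scope has INFINITE kernel, as here.
* §4 DESCENT route at tfg kernels: **`autCompatible_of_isTopologicallyFinitelyGenerated_ker [Normal ℚ F]`** — abc-iut-L5-t4's law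
  `AutCompatible ι` (`hdesc⊚ ⟺ AutCompatible ι`, ★ `Cor53iFcircHdescIffAutCompatible`) for EVERY tfg-kernel push carrier when `F/ℚ` is normal
  (§1's `τ` preserves `F`; `φ₀ :=` conjugation by `τ`, ★ `exists_continuousMulEquiv_conj`), FACT ∅ · SIDE {`Normal ℚ F`}; `GlobalFrobenioid.hdesc_pushCarrier_of_tfg_ker`;
  and the DESCENT-LAW EQUIVALENCE widened from open embeddings (★ `Cor53.forall_openEmbedding_hdesc_iff_normal`, gen 23) to tfg kernels:
  **`Cor53.forall_tfgKer_hdesc_iff_normal`** — «`hdesc⊚` at EVERY Galois-countable tfg-kernel push carrier, every record» ⟺ `Normal ℚ F`.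
HONEST LABEL: OUR stand-in carriers (push along `ι` of `ℬ(H)⁰`; print's `ι` is the open injection `π₁(C_K) ↪ π₁(C_{F_mod})`, Ex 5.1 (i)) and OUR
lift / descent routes; `F̂₂ × G_F` is a consistency witness (a direct product, not a `Π_X`); typed ≠ inhabited ≠ proved-in-print; no side on [IUTchIII]
Cor 3.12; not an abc claim.
-/

set_option backward.isDefEq.respectTransparency false

noncomputable section

namespace Literature.IUT.HodgeTheaters

open CategoryTheory Opposite Function
open Literature.AlgebraicGeometry.Frobenioids Literature.AnabelianGeometry.SemiGraphs
open Literature.AlgebraicGeometry.Frobenioids.QuasiTemperoid Literature.NumberTheory.GaloisRepresentations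
open Literature.AnabelianGeometry.AbsoluteAnabelian (IsTopologicallyFinitelyGenerated
  eq_bot_of_tfg_normal_of_isOpen_absoluteGaloisGroup_numberField)

/-! ### §1. KER-STABLE from a topologically finitely generated kernel — [AbsAnab] Thm 1.1.2, nothing else -/

section TfgKernel

variable (F : Type) [Field F] [NumberField F] (H : ProfiniteGrp.{0}) (ι : H →* GalFbar F) (hc : Continuous ι) (ho : IsOpenMap ι)

include hc ho in
/-- **KER-STABLE is AUTOMATIC for a topologically finitely generated kernel.**  For a continuous open `ι : H → G_F` (`H` profinite, `F` a
number field) with `Ker ι` topologically finitely generated, every topological automorphism `φ` of `H` maps `Ker ι` into `Ker ι`: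
the subgroup `ι(φ(Ker ι)) ≤ G_F` is topologically finitely generated (a continuous image of `Ker ι`), closed (a continuous image of the
compact `Ker ι`), contained and normal in the OPEN subgroup `ι(H)` (image of the normal subgroup `φ(Ker ι)` under `ι : H ↠ ι(H)`), hence
TRIVIAL by [AbsAnab] Thm 1.1.2 in the open-subgroup form of [AbsTopI] Thm 1.7 (iii) (★ `eq_bot_of_tfg_normal_of_isOpen_absoluteGaloisGroup_numberField`).
No slimness, countability or Neukirch–Uchida is used. ([IUTchI] Cor 5.3 (i) p.144) [cite: MochizukiAbsAnab2004, Thm 1.1.2 p.6]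
[cite: MochizukiAbsTopI2012, Thm 1.7 (iii) p.14] [claim: Mochizuki2012, status: disputed] -/
theorem kerStable_of_isTopologicallyFinitelyGenerated_ker (htfg : IsTopologicallyFinitelyGenerated ι.ker)
    (φ : H ≃ₜ* H) (h : H) (hh : ι h = 1) : ι (φ h) = 1 := by
  -- the composite `f = ι ∘ φ` and the image `N = f(Ker ι) ≤ G_F`
  let f : H →* GalFbar F := ι.comp φ.toMulEquiv.toMonoidHom
  have hf : Continuous f := hc.comp φ.continuous
  let N : Subgroup (Field.absoluteGaloisGroup F) := ι.ker.map f
  let U : Subgroup (Field.absoluteGaloisGroup F) := ι.range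
  -- `U = ι(H)` is open
  have hUo : IsOpen (U : Set (Field.absoluteGaloisGroup F)) := by
    change IsOpen ((ι.range : Subgroup (GalFbar F)) : Set (GalFbar F))
    rw [MonoidHom.coe_range]
    exact ho.isOpen_range
  -- `N ≤ U`
  have hNU : N ≤ U := by
    rintro _ ⟨k, -, rfl⟩
    exact ⟨φ k, rfl⟩
  -- `N` is normal in `U`
  have hNn : (N.subgroupOf U).Normal := by
    refine ⟨fun n hn g => ?_⟩
    rw [Subgroup.mem_subgroupOf] at hn ⊢
    obtain ⟨k, hk, hkn⟩ := Subgroup.mem_map.mp hn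
    obtain ⟨g', hg'⟩ := MonoidHom.mem_range.mp g.2
    refine Subgroup.mem_map.mpr ⟨φ.symm g' * k * (φ.symm g')⁻¹, ι.normal_ker.conj_mem k hk (φ.symm g'), ?_⟩
    have hfk : f k = n.1 := hkn
    have hfg : f (φ.symm g') = g.1 := by
      change ι (φ (φ.symm g')) = _
      rw [ContinuousMulEquiv.apply_symm_apply]
      exact hg'
    change f (φ.symm g' * k * (φ.symm g')⁻¹) = (g * n * g⁻¹).1
    rw [map_mul, map_mul, map_inv, hfk, hfg]
    rfl
  -- `N` is closed (a continuous image of the compact `Ker ι`)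
  have hKc : IsClosed (ι.ker : Set H) := by
    change IsClosed ((ι : H → GalFbar F) ⁻¹' {1})
    exact isClosed_singleton.preimage hc
  have hNc : IsClosed (N : Set (Field.absoluteGaloisGroup F)) := by
    change IsClosed ((ι.ker.map f : Subgroup (GalFbar F)) : Set (GalFbar F))
    rw [Subgroup.coe_map]
    exact (hKc.isCompact.image hf).isClosed
  -- `N` is topologically finitely generated (a continuous image of `Ker ι`)
  have hNfg : IsTopologicallyFinitelyGenerated N := by
    change IsTopologicallyFinitelyGenerated (ι.ker.map f : Subgroup (GalFbar F))
    refine htfg.of_surjective ⟨f.subgroupMap ι.ker, ?_⟩ (f.subgroupMap_surjective ι.ker)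
    exact (hf.comp continuous_subtype_val).subtype_mk _
  -- [AbsAnab] Thm 1.1.2 / [AbsTopI] Thm 1.7 (iii): `N = ⊥`
  have hbot : N = ⊥ := eq_bot_of_tfg_normal_of_isOpen_absoluteGaloisGroup_numberField F U N hUo hNU hNn hNc hNfg
  have hmem : f h ∈ N := Subgroup.mem_map.mpr ⟨h, (MonoidHom.mem_ker).mpr hh, rfl⟩
  rw [hbot] at hmem
  exact Subgroup.mem_bot.mp hmem

include hc ho in
/-- **Hence Neukirch–Uchida-compatibility of `ι` for a tfg kernel** (★ `nuCompatible_of_kerStable`): every topological automorphism `φ` of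
`H` is conjugation through `ι` by a field automorphism `τ` of `F̄` — `ι(φ h) (τ x) = τ (ι(h) x)`. ([IUTchI] Cor 5.3 (i) p.144)
[cite: NeukirchSchmidtWingberg2008, Thm (12.2.1)] [cite: MochizukiAbsAnab2004, Thm 1.1.2 p.6] [claim: Mochizuki2012, status: disputed] -/
theorem nuCompatible_of_isTopologicallyFinitelyGenerated_ker (htfg : IsTopologicallyFinitelyGenerated ι.ker) (φ : H ≃ₜ* H) :
    ∃ τ : Fbar F ≃+* Fbar F, ∀ (h : H) (x : Fbar F), ι (φ h) (τ x) = τ (ι h x) :=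
  nuCompatible_of_kerStable F H ι hc ho (kerStable_of_isTopologicallyFinitelyGenerated_ker F H ι hc ho htfg) φ

end TfgKernel

/-! ### §2. KNIT — `hlift⊚` and «⊚ bijective» at every (slim, Galois-countable) push carrier with tfg kernel: LAW ∅ · FACT ∅ -/

namespace GlobalFrobenioid

variable (F : Type) [Field F] [NumberField F]

/-- **`hlift⊚` at the push carrier of ANY continuous open `ι : H → G_F` with topologically finitely generated kernel** (`H` profinite,
Galois-countable), for EVERY record `†ℱ^⊛` of [IUTchI] Ex 5.1 (iii) over `ℬ(H)⁰ → ℬ(G_F)⁰`: every self-equivalence of `†𝒟^⊚ = ℬ(H)⁰` lifts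
to `†ℱ^⊚` — §1 + ★ `liftsAll_fcircBase_arith_of_pushCarrier_of_kerStable`; LAW ∅ · FACT ∅.  OUR carrier and OUR lift route.
([IUTchI] Cor 5.3 (i) p.144) [cite: MochizukiAbsAnab2004, Thm 1.1.2 p.6] [cite: NeukirchSchmidtWingberg2008, Thm (12.2.1)]
[claim: Mochizuki2012, status: disputed] -/
theorem liftsAll_fcircBase_arith_of_pushCarrier_of_tfg_ker
    (H : ProfiniteGrp.{0}) [SecondCountableTopology H] (ι : H →* GalFbar F) (hc : Continuous ι) (ho : IsOpenMap ι)
    (htfg : IsTopologicallyFinitelyGenerated ι.ker)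
    (𝓕 : GlobalFrobenioid (GlobalDivisorData.arith F) (BaseCat H)
      (baseToCoset H ⋙ CosetCat.push ι ho ⋙ cosetToBase (absGalGrp F))) :
    ∀ Θ : BaseCat H ≌ BaseCat H, ∃ Ψ : 𝓕.Fcirc ≌ 𝓕.Fcirc,
      Nonempty (CatIsomorphism.LiesUnder 𝓕.fcircBase 𝓕.fcircBase Ψ Θ) :=
  liftsAll_fcircBase_arith_of_pushCarrier_of_kerStable F H ι hc ho
    (kerStable_of_isTopologicallyFinitelyGenerated_ker F H ι hc ho htfg) 𝓕

end GlobalFrobenioid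

section Knit

variable (F : Type) [Field F] [NumberField F]

/-- **[IUTchI] Cor 5.3 (i) «resp. `⊚`» («bijective») at the push carrier of ANY continuous open `ι : H → G_F` with topologically finitely
generated kernel** (`H` profinite, Galois-countable, slim), for EVERY record: LAW ∅ · FACT ∅ · SIDE {`hZ`, `Ker ι` tfg} — §1 + ★
`Cor53.fcirc_descendBijective_of_pushCarrier_of_kerStable`.  The print-shaped class: an arithmetic-fundamental-group-like `H ↠ G_K ≤ G_F` whose
geometric part is topologically finitely generated (cf. [AbsAnab] Lemma 1.1.4 (i)).  OUR carrier and OUR lift route. ([IUTchI] Cor 5.3 (i) p.144)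
[cite: MochizukiAbsAnab2004, Thm 1.1.2 p.6] [cite: MochizukiFrdI2008, Prop. 1.6 p.27] [claim: Mochizuki2012, status: disputed] -/
theorem Cor53.fcirc_descendBijective_of_pushCarrier_of_tfg_ker
    (H : ProfiniteGrp.{0}) [SecondCountableTopology H] (ι : H →* GalFbar F) (hc : Continuous ι) (ho : IsOpenMap ι) (hZ : IsSlimGroup H)
    (htfg : IsTopologicallyFinitelyGenerated ι.ker)
    (𝓕 : GlobalFrobenioid (GlobalDivisorData.arith F) (BaseCat H)
      (baseToCoset H ⋙ CosetCat.push ι ho ⋙ cosetToBase (absGalGrp F))) :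
    CatIsomorphism.DescendBijective 𝓕.fcircBase 𝓕.fcircBase
      (GlobalFrobenioid.hasUnder_and_underUnique_fcircBase_arith_baseCat 𝓕 𝓕 hZ hZ).1
      (GlobalFrobenioid.hasUnder_and_underUnique_fcircBase_arith_baseCat 𝓕 𝓕 hZ hZ).2 :=
  Cor53.fcirc_descendBijective_of_pushCarrier_of_kerStable F H ι hc ho hZ
    (kerStable_of_isTopologicallyFinitelyGenerated_ker F H ι hc ho htfg) 𝓕

end Knit

/-! ### §3. An INHABITED NON-INJECTIVE instance: `F̂₂ × G_F ↠ G_F` (kernel `F̂₂` tfg and infinite; carrier slim and Galois-countable) -/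

section FreeTwoProd

variable (F : Type) [Field F] [NumberField F]

/-- `F̂₂ × G_F` is slim (★ `AbsTopIII.isSlimGroup_prod`; `F̂₂` slim ★ `isSlimGroup_profiniteCompletion_freeGroupTwo`, `G_F` slim ★
`isSlimGroup_absGalGrp`). ([IUTchI] Ex 5.1 (i) p.123) [cite: MochizukiSemiAnbd2006, Ex 3.10 p.44] [cite: MochizukiAbsAnab2004, Thm 1.1.1 (ii) p.6]
[claim: Mochizuki2012, status: disputed] -/
theorem isSlimGroup_freeProfiniteTwo_prod_absGalGrp :
    IsSlimGroup (ProfiniteGrp.of (profiniteCompletion (FreeGroup (Fin 2)) × absGalGrp F)) :=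
  Literature.AnabelianGeometry.AbsoluteAnabelian.AbsTopIII.isSlimGroup_prod
    isSlimGroup_profiniteCompletion_freeGroupTwo (isSlimGroup_absGalGrp F)

/-- The kernel of `pr₂ : F̂₂ × G_F → G_F` is topologically finitely generated: it is the continuous homomorphic image `a ↦ (a, 1)` of `F̂₂`
(★ `isTopologicallyFinitelyGenerated_profiniteCompletion_freeGroupTwo`). ([IUTchI] Ex 5.1 (i) p.123) [cite: MochizukiSemiAnbd2006, Ex 3.10 p.44]
[cite: MochizukiAbsTopI2012, §0 p.8] [claim: Mochizuki2012, status: disputed] -/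
theorem isTopologicallyFinitelyGenerated_ker_snd_freeProfiniteTwo_prod :
    IsTopologicallyFinitelyGenerated
      (MonoidHom.snd (profiniteCompletion (FreeGroup (Fin 2))) (absGalGrp F)).ker := by
  refine isTopologicallyFinitelyGenerated_profiniteCompletion_freeGroupTwo.of_surjective
    ⟨(MonoidHom.inl (profiniteCompletion (FreeGroup (Fin 2))) (absGalGrp F)).codRestrict
      (MonoidHom.snd (profiniteCompletion (FreeGroup (Fin 2))) (absGalGrp F)).ker (fun a => by
        rw [MonoidHom.mem_ker]; rfl), ?_⟩ ?_
  · exact (continuous_id.prodMk continuous_const).subtype_mk _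
  · rintro ⟨⟨a, b⟩, hb⟩
    have hb1 : b = 1 := hb
    subst hb1
    exact ⟨a, rfl⟩

/-- `pr₂ : F̂₂ × G_F → G_F` is NOT injective (`F̂₂` is infinite, ★ `infinite_profiniteCompletion_freeGroupTwo`): the instance below is a
genuinely NON-injective push carrier, its kernel `F̂₂ × 1` infinite — as it must be under `hZ` (a slim group has no finite normal subgroup
`≠ 1`, ★ `eq_bot_of_finite_normal_of_isSlimGroup`). ([IUTchI] Ex 5.1 (i) p.123) [cite: MochizukiSemiAnbd2006, Cor 1.7 p.20]
[claim: Mochizuki2012, status: disputed] -/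
theorem not_injective_snd_freeProfiniteTwo_prod :
    ¬ Injective (MonoidHom.snd (profiniteCompletion (FreeGroup (Fin 2))) (absGalGrp F)) := by
  intro hinj
  haveI := infinite_profiniteCompletion_freeGroupTwo
  obtain ⟨a, ha⟩ := exists_ne (1 : profiniteCompletion (FreeGroup (Fin 2)))
  have h := @hinj (a, 1) (1, 1) rfl
  exact ha (congrArg Prod.fst h)

/-- **KER-STABLE at the `pr₂` push carrier `F̂₂ × G_F ↠ G_F`** (§1 at a tfg kernel): every topological automorphism of `F̂₂ × G_F` maps
`F̂₂ × 1` into itself — contrast ★ `not_kerStable_fstPushCarrier` (`G_F × G_F ↠ G_F`: the kernel `G_F` is NOT topologically finitely generated,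
★ `not_isTopologicallyFinitelyGenerated_absoluteGaloisGroup`, and the swap breaks the law). ([IUTchI] Cor 5.3 (i) p.144)
[cite: MochizukiAbsAnab2004, Thm 1.1.2 p.6] [claim: Mochizuki2012, status: disputed] -/
theorem kerStable_sndPushCarrier_freeProfiniteTwo
    (φ : (ProfiniteGrp.of (profiniteCompletion (FreeGroup (Fin 2)) × absGalGrp F) : ProfiniteGrp.{0}) ≃ₜ*
      ProfiniteGrp.of (profiniteCompletion (FreeGroup (Fin 2)) × absGalGrp F))
    (h : (ProfiniteGrp.of (profiniteCompletion (FreeGroup (Fin 2)) × absGalGrp F) : ProfiniteGrp.{0}))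
    (hh : MonoidHom.snd (profiniteCompletion (FreeGroup (Fin 2))) (absGalGrp F) h = 1) :
    MonoidHom.snd (profiniteCompletion (FreeGroup (Fin 2))) (absGalGrp F) (φ h) = 1 :=
  kerStable_of_isTopologicallyFinitelyGenerated_ker F
    (ProfiniteGrp.of (profiniteCompletion (FreeGroup (Fin 2)) × absGalGrp F))
    (MonoidHom.snd (profiniteCompletion (FreeGroup (Fin 2))) (absGalGrp F)) continuous_snd isOpenMap_snd
    (isTopologicallyFinitelyGenerated_ker_snd_freeProfiniteTwo_prod F) φ h hh

/-- **Typed ≠ inhabited guard + verdict at `F̂₂ × G_F ↠ G_F`**: the [IUTchI] Ex 5.1 (iii) record type over this push carrier is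
INHABITED (★ `nonempty_globalFrobenioid`), and for EVERY inhabitant [IUTchI] Cor 5.3 (i) «resp. `⊚`» («bijective») HOLDS — LAW ∅ · FACT ∅ ·
SIDE ∅ (slimness, Galois-countability and the tfg kernel are theorems here).  Read against ★ `Cor53.nonempty_and_not_liftsAll_fstPushCarrier`
(`G_F × G_F ↠ G_F`: inhabited, `hlift⊚` false for every inhabitant).  OUR carrier (a direct product — a consistency witness, not a `Π_X`) and OUR
lift route. ([IUTchI] Cor 5.3 (i) p.144) [cite: MochizukiFrdI2008, Ex. 6.3 p.113] [cite: MochizukiAbsAnab2004, Thm 1.1.2 p.6]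
[claim: Mochizuki2012, status: disputed] -/
theorem Cor53.nonempty_and_fcirc_descendBijective_sndPushCarrier_freeProfiniteTwo :
    Nonempty (GlobalFrobenioid (GlobalDivisorData.arith F)
        (BaseCat (ProfiniteGrp.of (profiniteCompletion (FreeGroup (Fin 2)) × absGalGrp F)))
        (baseToCoset (ProfiniteGrp.of (profiniteCompletion (FreeGroup (Fin 2)) × absGalGrp F)) ⋙
          CosetCat.push (MonoidHom.snd (profiniteCompletion (FreeGroup (Fin 2))) (absGalGrp F)) isOpenMap_snd ⋙
            cosetToBase (absGalGrp F))) ∧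
      ∀ 𝓕 : GlobalFrobenioid (GlobalDivisorData.arith F)
          (BaseCat (ProfiniteGrp.of (profiniteCompletion (FreeGroup (Fin 2)) × absGalGrp F)))
          (baseToCoset (ProfiniteGrp.of (profiniteCompletion (FreeGroup (Fin 2)) × absGalGrp F)) ⋙
            CosetCat.push (MonoidHom.snd (profiniteCompletion (FreeGroup (Fin 2))) (absGalGrp F)) isOpenMap_snd ⋙
              cosetToBase (absGalGrp F)),
        CatIsomorphism.DescendBijective 𝓕.fcircBase 𝓕.fcircBase
          (GlobalFrobenioid.hasUnder_and_underUnique_fcircBase_arith_baseCat 𝓕 𝓕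
            (isSlimGroup_freeProfiniteTwo_prod_absGalGrp F) (isSlimGroup_freeProfiniteTwo_prod_absGalGrp F)).1
          (GlobalFrobenioid.hasUnder_and_underUnique_fcircBase_arith_baseCat 𝓕 𝓕
            (isSlimGroup_freeProfiniteTwo_prod_absGalGrp F) (isSlimGroup_freeProfiniteTwo_prod_absGalGrp F)).2 := by
  haveI : SecondCountableTopology (profiniteCompletion (FreeGroup (Fin 2))) :=
    secondCountableTopology_profiniteCompletion_freeGroup (Fin 2)
  haveI : SecondCountableTopology (GalFbar F) := GlobalDivisorData.secondCountableTopology_galFbar F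
  haveI : SecondCountableTopology
      (ProfiniteGrp.of (profiniteCompletion (FreeGroup (Fin 2)) × absGalGrp F) : ProfiniteGrp.{0}) := by
    change SecondCountableTopology (profiniteCompletion (FreeGroup (Fin 2)) × GalFbar F)
    infer_instance
  exact ⟨nonempty_globalFrobenioid _ _ _, fun 𝓕 =>
    Cor53.fcirc_descendBijective_of_pushCarrier_of_tfg_ker F
      (ProfiniteGrp.of (profiniteCompletion (FreeGroup (Fin 2)) × absGalGrp F))
      (MonoidHom.snd (profiniteCompletion (FreeGroup (Fin 2))) (absGalGrp F)) continuous_snd isOpenMap_snd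
      (isSlimGroup_freeProfiniteTwo_prod_absGalGrp F) (isTopologicallyFinitelyGenerated_ker_snd_freeProfiniteTwo_prod F) 𝓕⟩

end FreeTwoProd

/-! ### §4. DESCENT route at tfg kernels: `AutCompatible ι` for `F/ℚ` normal, and the descent-law equivalence widened to tfg kernels -/

section Descent

variable (F : Type) [Field F] [NumberField F]

/-- **`AutCompatible ι` at EVERY tfg-kernel push carrier, for `F/ℚ` normal — FACT ∅ · SIDE {`Normal ℚ F`}** (abc-iut-L5-t4's descent law;
`hdesc⊚ ⟺ AutCompatible ι`, ★ `Cor53iFcircHdescIffAutCompatible`): by §1 every topological automorphism `φ` of `H` is conjugation through `ι` by a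
field automorphism `τ` of `F̄`; for `F/ℚ` normal `τ(F) = F` (★ `exists_algebraMap_eq_of_normal`), so conjugation by `τ` is a topological
automorphism `φ₀` of `G_F` (★ `exists_continuousMulEquiv_conj`) with `ι (φ h) = φ₀ (ι h)` (`g := 1`) — the proof of ★ `autCompatible_of_neukirchUchida`
with injectivity replaced by §1.  ([IUTchI] Cor 5.3 (i) p.144) [cite: MochizukiAbsAnab2004, Thm 1.1.2 p.6] [cite: NeukirchSchmidtWingberg2008, Thm (12.2.1)]
[claim: Mochizuki2012, status: disputed] -/
theorem autCompatible_of_isTopologicallyFinitelyGenerated_ker [Normal ℚ F]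
    (H : ProfiniteGrp.{0}) (ι : H →* GalFbar F) (hc : Continuous ι) (ho : IsOpenMap ι)
    (htfg : IsTopologicallyFinitelyGenerated ι.ker) :
    ∀ φ : H ≃ₜ* H, ∃ (φ₀ : GalFbar F ≃ₜ* GalFbar F) (g : GalFbar F), ∀ x, ι (φ x) = g * φ₀ (ι x) * g⁻¹ := by
  intro φ
  obtain ⟨τ, hτ⟩ := nuCompatible_of_isTopologicallyFinitelyGenerated_ker F H ι hc ho htfg φ
  obtain ⟨φ₀, hφ₀⟩ := exists_continuousMulEquiv_conj F τ (exists_algebraMap_eq_of_normal F τ)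
    (exists_algebraMap_eq_of_normal F τ.symm)
  refine ⟨φ₀, 1, fun h => ?_⟩
  rw [one_mul, inv_one, mul_one]
  ext x
  obtain ⟨y, rfl⟩ := τ.surjective x
  rw [hτ, hφ₀]

/-- **`hdesc⊚` at EVERY Galois-countable tfg-kernel push carrier, for `F/ℚ` normal**, every divisor data `Δ` and every record (§4's law fed to
★ `GlobalFrobenioid.hdesc_pushCarrier_of_autCompatible`): every self-equivalence of `†𝒟^⊚ = ℬ(H)⁰` descends along `†𝒟^⊚ → Base(†ℱ^⊛)`.
FACT ∅ · SIDE {`Normal ℚ F`}.  OUR carrier and OUR descent route. ([IUTchI] Ex 5.1 (iii) p.125) [cite: MochizukiFrdII2008, Ex 1.3 (ii) p.11]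
[cite: MochizukiAbsAnab2004, Thm 1.1.2 p.6] [claim: Mochizuki2012, status: disputed] -/
theorem GlobalFrobenioid.hdesc_pushCarrier_of_tfg_ker [Normal ℚ F]
    (H : ProfiniteGrp.{0}) [SecondCountableTopology H] (ι : H →* GalFbar F) (hc : Continuous ι) (ho : IsOpenMap ι)
    (htfg : IsTopologicallyFinitelyGenerated ι.ker) {Δ : GlobalDivisorData (absGalGrp F)}
    (𝓕 : GlobalFrobenioid Δ (BaseCat H) (baseToCoset H ⋙ CosetCat.push ι ho ⋙ cosetToBase (absGalGrp F))) :
    ∀ Θ : BaseCat H ≌ BaseCat H, ∃ ΘB : 𝓕.Base ≌ 𝓕.Base, Nonempty (Θ.functor ⋙ 𝓕.baseMor ≅ 𝓕.baseMor ⋙ ΘB.functor) :=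
  GlobalFrobenioid.hdesc_pushCarrier_of_autCompatible F H ι ho
    (autCompatible_of_isTopologicallyFinitelyGenerated_ker F H ι hc ho htfg) 𝓕

/-- **The DESCENT-LAW EQUIVALENCE at tfg kernels** (gen 23's ★ `Cor53.forall_openEmbedding_hdesc_iff_normal` WIDENED from open embeddings to
every Galois-countable push carrier with topologically finitely generated kernel): «`hdesc⊚` holds at EVERY such carrier, for every record over
the arithmetic divisor data» ⟺ «`F/ℚ` is normal».  ⟸: the preceding theorem; ⟹: open embeddings are tfg-kernel carriers (kernel trivial,
Galois-countable by ★ `secondCountableTopology_of_openEmbedding`), and at them the law already forces normality (★ `Cor53.normal_of_forall_openEmbedding_hdesc`,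
abc-iut-L5-t4 / gen 22).  FACT ∅.  So at OUR `G_F` stand-in the lift route (§2) carries NO side hypothesis on the whole tfg-kernel class while the
descent route carries exactly {`Normal ℚ F`} — the reading of RULINGS #249/#253 extended from embeddings to tfg kernels.  OUR carriers; no side on
[IUTchIII] Cor 3.12; not an abc claim. ([IUTchI] Cor 5.3 (i) p.144) [cite: MochizukiAbsAnab2004, Thm 1.1.1 (ii) p.6]
[cite: MochizukiAbsAnab2004, Thm 1.1.2 p.6] [claim: Mochizuki2012, status: disputed] -/
theorem Cor53.forall_tfgKer_hdesc_iff_normal :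
    (∀ (H : ProfiniteGrp.{0}) (_ : SecondCountableTopology H) (ι : H →* GalFbar F) (_ : Continuous ι) (ho : IsOpenMap ι)
      (_ : IsTopologicallyFinitelyGenerated ι.ker)
      (𝓕 : GlobalFrobenioid (GlobalDivisorData.arith F) (BaseCat H)
        (baseToCoset H ⋙ CosetCat.push ι ho ⋙ cosetToBase (absGalGrp F))),
      ∀ Θ : BaseCat H ≌ BaseCat H, ∃ ΘB : 𝓕.Base ≌ 𝓕.Base, Nonempty (Θ.functor ⋙ 𝓕.baseMor ≅ 𝓕.baseMor ⋙ ΘB.functor)) ↔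
      Normal ℚ F := by
  refine ⟨fun h => Cor53.normal_of_forall_openEmbedding_hdesc F fun H ι hc ho hinj 𝓕 => ?_, fun hN H _ ι hc ho htfg 𝓕 => ?_⟩
  · -- an open embedding is a Galois-countable tfg-kernel carrier (its kernel is trivial)
    have htfg : IsTopologicallyFinitelyGenerated ι.ker := by
      refine ⟨⟨∅, eq_top_iff.mpr fun x _ => ?_⟩⟩
      have hx1 : ι (x : H) = ι 1 := by rw [map_one]; exact (MonoidHom.mem_ker).mp x.2
      have hx : x = 1 := Subtype.ext (hinj hx1)
      rw [hx]
      exact one_mem _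
    exact h H (secondCountableTopology_of_openEmbedding F H ι hc hinj) ι hc ho htfg 𝓕
  · haveI := hN
    exact GlobalFrobenioid.hdesc_pushCarrier_of_tfg_ker F H ι hc ho htfg 𝓕

end Descent

end Literature.IUT.HodgeTheaters

end
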